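import Literature.MathematicalPhysics.QuantumLattice.KMSMomentRowLineCertificate
import HarnessLib

/-!
# KMS moment cuts, VI: the rows on SPLIT (Krylov) words — stationarity moves the iterated
# commutator across the product, so order-`k` data need windows of radius `max(i, k − i)`, not `k`

Topic `Literature/MathematicalPhysics/QuantumLattice`; a companion of
`InfVolFermionStateTorusLimitKMSMomentCuts.lean` (p542543) and `KMSMomentRowLineCertificate.lean` (p544977).
Those files state the KMS moment cuts / rows of the thermal torus-limit object on the UNBALANCED words
`(Γa_l)ᴴ · ad^k(Γa_{l'})` and `ad^k(Γa_{l'}) · (Γa_l)ᴴ`, whose `k`-fold commutator with the free-boundary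
window Hamiltonian is the true derivation power only in a window `Λ' ⊇ (thicken · 1)^[K] Λ` — the support
radius of the data grows like the ORDER `K`.

Every translated canonical Gibbs component `U_vψ_{L,c}` of the torus is an eigenvector of `H_L`, hence
STATIONARY: `⟨U_vψ, (H_L Y − Y H_L) U_vψ⟩ = 0` for every `Y`
(`star_fockTranslate_mulVec_dotProduct_commutator_mulVec_eq_zero`). For a stationary functional `φ` and
`ad = ad_A` with `A` Hermitian, the Leibniz rule and `(ad X)ᴴ = −ad(Xᴴ)` give

  `φ(Xᴴ · ad^{i+j} Z) = φ((ad^i X)ᴴ · ad^j Z)`,  `φ(ad^{i+j}(Z) · Xᴴ) = φ(ad^j(Z) · (ad^i X)ᴴ)`  (§1)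

(no sign) — the `k`-th two-sided spectral moments of the generators are carried by ANY split
`k = i + j` of the commutators between the two factors («Hankel structure» of the Krylov Gram data;
Itoi–Ishimori–Sato–Sakamoto, Lemma 5: `ω^{2k} Q_{A†,A} = Q_{C_A^k†, C_A^k}`). Consequently the KMS moment cut

  `R_i = Σ_k Σ_{l l'} β^k [(P_k)_{l l'} · (ad^{i_k} Γa_l)ᴴ ad^{k−i_k}(Γa_{l'}) + (Q_k)_{l l'} · ad^{k−i_k}(Γa_{l'}) (ad^{i_k} Γa_l)ᴴ]`

for an arbitrary split `i_k ≤ k` (`k ≤ K`) has, in every translated Gibbs component, the SAME expectation as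
the unbalanced cut `R` of `TorusGibbsKMSMomentCuts.lean`, and is therefore nonnegative on the torus-limit
object under the same one-parameter condition `Σ_k u^k P_k + e^{−u} Σ_k u^k Q_k ⪰ 0` (`u ∈ ℝ`) — but the
window hypothesis is only `(thicken · 1)^[i_k] Λ ⊆ Λ'` and `(thicken · 1)^[k − i_k] Λ ⊆ Λ'` for every `k`,
i.e. radius `⌈K/2⌉` for the balanced split `i_k = ⌊k/2⌋` (§2 finite volume, §3 the torus-limit rows:
matrix cut, scalar row, and the line-certificate glue in the list format of `ExpPolynomialLineNonneg.lean`;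
§4 the same on a finite cluster's canonical sector Gibbs eigen-mixture, for unit tests of split-word producers).
For a producer this means: an order-`K` KMS moment row on a bond generator needs the Gram/word data of
`{a, ad a, …, ad^{⌈K/2⌉} a}` inside its blocks (or any other split its blocks happen to contain), never
the radius-`K` word `aᴴ ad^K a`, and no norm slack for the far part of `ad^K a`.

Everything is PROVED; no definition, no named fact.

## Mathlib / tree search

REUSED: `sum_sectorGibbsWeightTT'_mul_re_expect_momentCut_fockTranslate_nonneg`,
`iterate_hubbardTorusTT'_commutator_fermionEmbed` (`TorusGibbsKMSMomentCuts`),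
`star_fockTranslate_mulVec_dotProduct_commutator_mulVec_eq_zero` (`TorusGibbsEnergyEntropyBalance`),
`posSemidef_momentCut_unit_of_nonneg` (`GibbsKMSMomentCutsSector`), `momentRow_hyp_of_expPolyLine_nonneg`
(`ExpPolynomialLineNonneg`), `commute_fermionEmbed_toTorusEmb_totalNumber/spinZ`, `torusAvgExpectAt_of_injOn`,
`torusAvgExpect_eq`, `eventually_injOn_proj_of_tendsto`, `fermionEmbed_fermionEmbed/congr/sum/add/smul/mul/conjTranspose`
(`InfVolFermionState` & co.); Mathlib `Matrix.sum_mulVec`, `dotProduct_sum`, `Matrix.smul_mulVec`, `dotProduct_smul`.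
`lean search 'momentCut|momentRow|adPow'` (2026-08-27): the companion files I–V and lit-1's twin
(`GibbsKMSMomentRow`, `InfVolFermionStateTorusLimitKMSMomentRow`, `KMSMomentRowDictionary`) all use the unbalanced
words with window `(thicken · 1)^[K] Λ`; no split-word form in the tree.

## References

* C. Itoi, H. Ishimori, K. Sato, Y. Sakamoto, *Extended series of correlation inequalities in quantum
  systems*, J. Phys. Soc. Jpn. 92 (2023) 074001 = arXiv:2306.03489, §3 Lemma 5
  (`ω^{2k} Q_{A†,A}(ω) = Q_{C_A^k†,C_A^k}(ω)`: the moments of order `2k` are the Gram data of `C_A^k = ad_H^k A`).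
  [cite: ItoiEtAl2023, Lemma 5]
* H. Fawzi, O. Fawzi, S. O. Scalet, Nat. Commun. 15 (2024) 7394 = arXiv:2311.18706, §3.1 Thm. 3.1 (a)
  (stationarity `ω([H, Y]) = 0` of the certified relaxation) and §3.2 Thm. 3.4. [cite: FawziFawziScalet2024, Thm. 3.1]
* O. Bratteli, D. W. Robinson, *OAQSM 2* (1997), Thm. 6.2.4 (local iterated derivations live in a window
  containing the range-neighbourhood of the support). [cite: BratteliRobinsonII1997, Thm. 6.2.4]
-/

noncomputable section

namespace Literature.MathematicalPhysics.QuantumLattice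

open Matrix Finset HubbardWave0 Literature.Probability.LatticeModels ThermodynamicLimit
open Literature.Analysis.ValidatedNumerics Literature.Analysis.ValidatedNumerics.ExpPoly
open _root_.Filter
open scoped _root_.Topology ComplexOrder BigOperators

/-! ### §1 Stationary functionals move iterated commutators across a product -/

section Stationary

variable {ι : Type*} [Fintype ι]
variable {m : Type*} [Fintype m]

/-- **Leibniz rule, left factor adjoint**: for Hermitian `A` and `ad(Y) = AY − YA`,
`Xᴴ · ad(W) = ad(Xᴴ W) + (ad X)ᴴ · W` (because `(ad X)ᴴ = −ad(Xᴴ)`). [cite: ItoiEtAl2023, Lemma 5] -/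
theorem conjTranspose_mul_commutator_eq {A : Matrix ι ι ℂ} (hA : A.IsHermitian) (X W : Matrix ι ι ℂ) :
    Xᴴ * (A * W - W * A) = (A * (Xᴴ * W) - Xᴴ * W * A) + (A * X - X * A)ᴴ * W := by
  rw [conjTranspose_sub, conjTranspose_mul, conjTranspose_mul, hA.eq]
  simp only [Matrix.mul_sub, Matrix.sub_mul, Matrix.mul_assoc]
  abel

/-- **Leibniz rule, right factor adjoint**: for Hermitian `A` and `ad(Y) = AY − YA`,
`ad(W) · Xᴴ = ad(W Xᴴ) + W · (ad X)ᴴ`. [cite: ItoiEtAl2023, Lemma 5] -/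
theorem commutator_mul_conjTranspose_eq {A : Matrix ι ι ℂ} (hA : A.IsHermitian) (X W : Matrix ι ι ℂ) :
    (A * W - W * A) * Xᴴ = (A * (W * Xᴴ) - W * Xᴴ * A) + W * (A * X - X * A)ᴴ := by
  rw [conjTranspose_sub, conjTranspose_mul, conjTranspose_mul, hA.eq]
  simp only [Matrix.mul_sub, Matrix.sub_mul, Matrix.mul_assoc]
  abel

/-- **Moment transfer in a stationary vector state, left form.** If `⟨ψ, (AY − YA)ψ⟩ = 0` for every `Y`
(`ψ` an eigenvector of the Hermitian `A`, e.g. a Gibbs component), then for all `X, Z` and `i, j`: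
`⟨ψ, Xᴴ ad^{i+j}(Z) ψ⟩ = ⟨ψ, (ad^i X)ᴴ ad^j(Z) ψ⟩` — the `(i+j)`-th moment is the Gram datum of the Krylov
words `ad^i X`, `ad^j Z` (Itoi et al. Lemma 5, `ω^{2k}Q_{A†,A} = Q_{C^k†,C^k}`). [cite: ItoiEtAl2023, Lemma 5] -/
theorem star_dotProduct_conjTranspose_mul_iterate_commutator_mulVec_eq {A : Matrix ι ι ℂ} (hA : A.IsHermitian)
    {ψ : ι → ℂ} (hψ : ∀ Y : Matrix ι ι ℂ, star ψ ⬝ᵥ ((A * Y - Y * A) *ᵥ ψ) = 0)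
    (Z : Matrix ι ι ℂ) (j : ℕ) :
    ∀ (i : ℕ) (X : Matrix ι ι ℂ),
      star ψ ⬝ᵥ ((Xᴴ * (fun Y : Matrix ι ι ℂ => A * Y - Y * A)^[i + j] Z) *ᵥ ψ) =
        star ψ ⬝ᵥ ((((fun Y : Matrix ι ι ℂ => A * Y - Y * A)^[i] X)ᴴ *
          (fun Y : Matrix ι ι ℂ => A * Y - Y * A)^[j] Z) *ᵥ ψ) := by
  intro i
  induction i with
  | zero => intro X; simp only [Nat.zero_add, Function.iterate_zero, id_eq]
  | succ i ih =>
    intro X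
    rw [show i + 1 + j = (i + j) + 1 by omega, Function.iterate_succ_apply', conjTranspose_mul_commutator_eq hA,
      add_mulVec, dotProduct_add, hψ, zero_add, ih (A * X - X * A), Function.iterate_succ_apply]

/-- **Moment transfer in a stationary vector state, right form**: under the same hypothesis,
`⟨ψ, ad^{i+j}(Z) Xᴴ ψ⟩ = ⟨ψ, ad^j(Z) (ad^i X)ᴴ ψ⟩`. [cite: ItoiEtAl2023, Lemma 5] -/
theorem star_dotProduct_iterate_commutator_mul_conjTranspose_mulVec_eq {A : Matrix ι ι ℂ} (hA : A.IsHermitian)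
    {ψ : ι → ℂ} (hψ : ∀ Y : Matrix ι ι ℂ, star ψ ⬝ᵥ ((A * Y - Y * A) *ᵥ ψ) = 0)
    (Z : Matrix ι ι ℂ) (j : ℕ) :
    ∀ (i : ℕ) (X : Matrix ι ι ℂ),
      star ψ ⬝ᵥ (((fun Y : Matrix ι ι ℂ => A * Y - Y * A)^[i + j] Z * Xᴴ) *ᵥ ψ) =
        star ψ ⬝ᵥ (((fun Y : Matrix ι ι ℂ => A * Y - Y * A)^[j] Z *
          ((fun Y : Matrix ι ι ℂ => A * Y - Y * A)^[i] X)ᴴ) *ᵥ ψ) := by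
  intro i
  induction i with
  | zero => intro X; simp only [Nat.zero_add, Function.iterate_zero, id_eq]
  | succ i ih =>
    intro X
    rw [show i + 1 + j = (i + j) + 1 by omega, Function.iterate_succ_apply', commutator_mul_conjTranspose_eq hA,
      add_mulVec, dotProduct_add, hψ, zero_add, ih (A * X - X * A), Function.iterate_succ_apply]

/-- **A KMS moment cut on split (Krylov) words has the same stationary expectation as the unbalanced
cut.** For generators `b_l`, coefficient matrices `P_k, Q_k`, a split `i_k ≤ k`, and a vector `ψ` with
`⟨ψ, (AY − YA)ψ⟩ = 0` for all `Y`: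
`⟨ψ, Σ_k Σ_{l l'} β^k [(P_k)_{l l'} (ad^{i_k} b_l)ᴴ ad^{k−i_k}(b_{l'}) + (Q_k)_{l l'} ad^{k−i_k}(b_{l'}) (ad^{i_k} b_l)ᴴ] ψ⟩
 = ⟨ψ, Σ_k Σ_{l l'} β^k [(P_k)_{l l'} b_lᴴ ad^k(b_{l'}) + (Q_k)_{l l'} ad^k(b_{l'}) b_lᴴ] ψ⟩`.
[cite: ItoiEtAl2023, Lemma 5] -/
theorem star_dotProduct_momentCutSplit_mulVec_eq {A : Matrix ι ι ℂ} (hA : A.IsHermitian)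
    {ψ : ι → ℂ} (hψ : ∀ Y : Matrix ι ι ℂ, star ψ ⬝ᵥ ((A * Y - Y * A) *ᵥ ψ) = 0)
    (b : m → Matrix ι ι ℂ) (β : ℝ) {K : ℕ} (P Q : Fin (K + 1) → Matrix m m ℂ)
    (i : Fin (K + 1) → ℕ) (hi : ∀ k, i k ≤ (k : ℕ)) :
    star ψ ⬝ᵥ ((∑ k : Fin (K + 1), ∑ l, ∑ l',
        ((((β ^ (k : ℕ) : ℝ) : ℂ) * P k l l') •
            (((fun Y : Matrix ι ι ℂ => A * Y - Y * A)^[i k] (b l))ᴴ *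
              (fun Y : Matrix ι ι ℂ => A * Y - Y * A)^[(k : ℕ) - i k] (b l')) +
          (((β ^ (k : ℕ) : ℝ) : ℂ) * Q k l l') •
            ((fun Y : Matrix ι ι ℂ => A * Y - Y * A)^[(k : ℕ) - i k] (b l') *
              ((fun Y : Matrix ι ι ℂ => A * Y - Y * A)^[i k] (b l))ᴴ))) *ᵥ ψ) =
      star ψ ⬝ᵥ ((∑ k : Fin (K + 1), ∑ l, ∑ l',
        ((((β ^ (k : ℕ) : ℝ) : ℂ) * P k l l') • ((b l)ᴴ * (fun Y : Matrix ι ι ℂ => A * Y - Y * A)^[(k : ℕ)] (b l')) +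
          (((β ^ (k : ℕ) : ℝ) : ℂ) * Q k l l') • ((fun Y : Matrix ι ι ℂ => A * Y - Y * A)^[(k : ℕ)] (b l') * (b l)ᴴ))) *ᵥ ψ) := by
  simp only [Matrix.sum_mulVec, dotProduct_sum, Matrix.add_mulVec, dotProduct_add, Matrix.smul_mulVec,
    dotProduct_smul]
  refine Finset.sum_congr rfl fun k _ => Finset.sum_congr rfl fun l _ => Finset.sum_congr rfl fun l' _ => ?_
  have hk : i k + ((k : ℕ) - i k) = (k : ℕ) := Nat.add_sub_cancel' (hi k)
  have e1 := star_dotProduct_conjTranspose_mul_iterate_commutator_mulVec_eq hA hψ (b l') ((k : ℕ) - i k) (i k) (b l)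
  have e2 := star_dotProduct_iterate_commutator_mul_conjTranspose_mulVec_eq hA hψ (b l') ((k : ℕ) - i k) (i k) (b l)
  rw [hk] at e1 e2
  rw [e1, e2]

/-- The `m = Unit` bookkeeping for scalar rows on arbitrary word families `W_k, W'_k` (cf.
`momentCut_unit_eq`). [cite: ItoiEtAl2023, Theorem 3] -/
theorem momentCut_unit_eq_of_words {κ : Type*} (β : ℝ) {K : ℕ} (W W' : Fin (K + 1) → Matrix κ κ ℂ)
    (p q : Fin (K + 1) → ℝ) :
    (∑ k : Fin (K + 1), ∑ i : Unit, ∑ j : Unit,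
        ((((β ^ (k : ℕ) : ℝ) : ℂ) * (((p k : ℝ) : ℂ) • (1 : Matrix Unit Unit ℂ)) i j) • W k +
          (((β ^ (k : ℕ) : ℝ) : ℂ) * (((q k : ℝ) : ℂ) • (1 : Matrix Unit Unit ℂ)) i j) • W' k)) =
      ∑ k : Fin (K + 1), ((((β ^ (k : ℕ) * p k : ℝ) : ℂ)) • W k + (((β ^ (k : ℕ) * q k : ℝ) : ℂ)) • W' k) := by
  refine Finset.sum_congr rfl fun k _ => ?_
  rw [Fintype.sum_unique, Fintype.sum_unique]
  simp only [Matrix.smul_apply, Matrix.one_apply_eq, smul_eq_mul, mul_one, Complex.ofReal_mul,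
    Complex.ofReal_pow]

end Stationary

/-! ### §2 Translation averages of the embedded local cuts on split words -/

section TorusAverage

variable (L : ℕ) [NeZero L] (t t' U : ℝ) {m : Type*} [Fintype m]

/-- **The KMS moment cut on split (Krylov) words of local generators, averaged over the torus
translations, is nonnegative in the canonical Gibbs mixture.** For a region `Λ`, a split `i_k ≤ k`
(`k ≤ K`), a window `Λ' ⊇ Λ` containing the shells `(thicken · 1)^[i_k] Λ` and `(thicken · 1)^[k − i_k] Λ` for
every `k`, with `x ↦ x mod L` injective on `thicken Λ' 1`, generators `a_l ∈ 𝔄_Λ` conserving the local `N` and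
`S^z`, `Γ = Γ_{Λ⊆Λ'}`, `H_{Λ'}` the free-boundary `t–t'–U` Hamiltonian of `Λ'`, and coefficient matrices with
`Σ_k u^k P_k + e^{−u} Σ_k u^k Q_k ⪰ 0` for all real `u`:
`0 ≤ Re Σ_c p_{L,c} · torusAvgExpectAt L Λ' (Σ_k Σ_{l l'} β^k [(P_k)_{l l'} (ad^{i_k}_{H_{Λ'}} Γa_l)ᴴ ad^{k−i_k}_{H_{Λ'}}(Γa_{l'}) +
(Q_k)_{l l'} ad^{k−i_k}_{H_{Λ'}}(Γa_{l'}) (ad^{i_k}_{H_{Λ'}} Γa_l)ᴴ]) ψ_{L,c}` — each factor pulls back to the torus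
separately (`ad_{H_L}^i(ΓΓa) = Γ(ad_{H_{Λ'}}^i Γa)` needs only the `i`-th shell), and in every translated Gibbs
component the split word has the expectation of the unbalanced one (stationarity, §1).
[cite: FawziFawziScalet2024, Thm. 3.1] [cite: ItoiEtAl2023, Lemma 5] -/
theorem re_sum_sectorGibbsWeightTT'_mul_torusAvgExpectAt_momentCutSplit_nonneg (n β : ℝ) {Λ Λ' : Finset (Site 2)}
    (hΛ : Λ ⊆ Λ') {K : ℕ} (i : Fin (K + 1) → ℕ) (hi : ∀ k, i k ≤ (k : ℕ))
    (hKi : ∀ k : Fin (K + 1), (fun S : Finset (Site 2) => thicken S 1)^[i k] Λ ⊆ Λ')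
    (hKj : ∀ k : Fin (K + 1), (fun S : Finset (Site 2) => thicken S 1)^[(k : ℕ) - i k] Λ ⊆ Λ')
    (hInj : Set.InjOn (Torus.proj (d := 2) L) ↑(thicken Λ' 1))
    {a : m → FermionOp Λ} (haN : ∀ l, Commute (a l) totalNumber) (haS : ∀ l, Commute (a l) HubbardWave0.spinZ)
    {P Q : Fin (K + 1) → Matrix m m ℂ}
    (hPi : ∀ u : ℝ, (∑ k : Fin (K + 1), ((u ^ (k : ℕ) : ℝ) : ℂ) • P k +
        ((Real.exp (-u) : ℝ) : ℂ) • ∑ k : Fin (K + 1), ((u ^ (k : ℕ) : ℝ) : ℂ) • Q k).PosSemidef) :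
    0 ≤ (∑ c, (sectorGibbsWeightTT' β t t' U n L c : ℂ) *
      torusAvgExpectAt L Λ'
        (∑ k : Fin (K + 1), ∑ l, ∑ l',
          ((((β ^ (k : ℕ) : ℝ) : ℂ) * P k l l') •
              (((fun Y : FermionOp Λ' => (hubbardTTPrimeFermionInteraction t t' U).localHamiltonian Λ' * Y -
                  Y * (hubbardTTPrimeFermionInteraction t t' U).localHamiltonian Λ')^[i k]
                (fermionEmbed (PolySite.incl hΛ) (a l)))ᴴ *
              (fun Y : FermionOp Λ' => (hubbardTTPrimeFermionInteraction t t' U).localHamiltonian Λ' * Y -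
                  Y * (hubbardTTPrimeFermionInteraction t t' U).localHamiltonian Λ')^[(k : ℕ) - i k]
                (fermionEmbed (PolySite.incl hΛ) (a l'))) +
            (((β ^ (k : ℕ) : ℝ) : ℂ) * Q k l l') •
              ((fun Y : FermionOp Λ' => (hubbardTTPrimeFermionInteraction t t' U).localHamiltonian Λ' * Y -
                  Y * (hubbardTTPrimeFermionInteraction t t' U).localHamiltonian Λ')^[(k : ℕ) - i k]
                (fermionEmbed (PolySite.incl hΛ) (a l')) *
              ((fun Y : FermionOp Λ' => (hubbardTTPrimeFermionInteraction t t' U).localHamiltonian Λ' * Y -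
                  Y * (hubbardTTPrimeFermionInteraction t t' U).localHamiltonian Λ')^[i k]
                (fermionEmbed (PolySite.incl hΛ) (a l)))ᴴ)))
        (sectorGibbsVectorTT' t t' U n L c)).re := by
  have h₁ : Set.InjOn (Torus.proj (d := 2) L) ↑Λ' :=
    hInj.mono (by exact_mod_cast subset_thicken Λ' 1)
  have hΛ₀ : Set.InjOn (Torus.proj (d := 2) L) ↑Λ := h₁.mono (by exact_mod_cast hΛ)
  -- the embedded generators on the torus
  set b : m → Matrix (Finset (Orb (FermionTorus 2 L))) (Finset (Orb (FermionTorus 2 L))) ℂ :=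
    fun l => fermionEmbed (PolySite.toTorusEmb L hΛ₀) (a l) with hbdef
  have hb : ∀ l, fermionEmbed (PolySite.toTorusEmb L h₁) (fermionEmbed (PolySite.incl hΛ) (a l)) = b l := by
    intro l
    rw [hbdef]
    dsimp only
    rw [fermionEmbed_fermionEmbed]
    exact congrFun (congrArg DFunLike.coe (fermionEmbed_congr fun q => rfl)) (a l)
  have hbN : ∀ l, Commute (b l) totalNumber := fun l => commute_fermionEmbed_toTorusEmb_totalNumber L hΛ₀ (haN l)
  have hbS : ∀ l, Commute (b l) HubbardWave0.spinZ := fun l => commute_fermionEmbed_toTorusEmb_spinZ L hΛ₀ (haS l)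
  -- pull the split cut back into the torus, factor by factor
  have hΓ : fermionEmbed (PolySite.toTorusEmb L h₁)
      (∑ k : Fin (K + 1), ∑ l, ∑ l',
          ((((β ^ (k : ℕ) : ℝ) : ℂ) * P k l l') •
              (((fun Y : FermionOp Λ' => (hubbardTTPrimeFermionInteraction t t' U).localHamiltonian Λ' * Y -
                  Y * (hubbardTTPrimeFermionInteraction t t' U).localHamiltonian Λ')^[i k]
                (fermionEmbed (PolySite.incl hΛ) (a l)))ᴴ *
              (fun Y : FermionOp Λ' => (hubbardTTPrimeFermionInteraction t t' U).localHamiltonian Λ' * Y -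
                  Y * (hubbardTTPrimeFermionInteraction t t' U).localHamiltonian Λ')^[(k : ℕ) - i k]
                (fermionEmbed (PolySite.incl hΛ) (a l'))) +
            (((β ^ (k : ℕ) : ℝ) : ℂ) * Q k l l') •
              ((fun Y : FermionOp Λ' => (hubbardTTPrimeFermionInteraction t t' U).localHamiltonian Λ' * Y -
                  Y * (hubbardTTPrimeFermionInteraction t t' U).localHamiltonian Λ')^[(k : ℕ) - i k]
                (fermionEmbed (PolySite.incl hΛ) (a l')) *
              ((fun Y : FermionOp Λ' => (hubbardTTPrimeFermionInteraction t t' U).localHamiltonian Λ' * Y -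
                  Y * (hubbardTTPrimeFermionInteraction t t' U).localHamiltonian Λ')^[i k]
                (fermionEmbed (PolySite.incl hΛ) (a l)))ᴴ))) =
      ∑ k : Fin (K + 1), ∑ l, ∑ l',
        ((((β ^ (k : ℕ) : ℝ) : ℂ) * P k l l') •
            (((fun X => hubbardTorusTT' L t t' U * X - X * hubbardTorusTT' L t t' U)^[i k] (b l))ᴴ *
              (fun X => hubbardTorusTT' L t t' U * X - X * hubbardTorusTT' L t t' U)^[(k : ℕ) - i k] (b l')) +
          (((β ^ (k : ℕ) : ℝ) : ℂ) * Q k l l') •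
            ((fun X => hubbardTorusTT' L t t' U * X - X * hubbardTorusTT' L t t' U)^[(k : ℕ) - i k] (b l') *
              ((fun X => hubbardTorusTT' L t t' U * X - X * hubbardTorusTT' L t t' U)^[i k] (b l))ᴴ)) := by
    rw [fermionEmbed_sum]
    refine Finset.sum_congr rfl fun k _ => ?_
    rw [fermionEmbed_sum]
    refine Finset.sum_congr rfl fun l _ => ?_
    rw [fermionEmbed_sum]
    refine Finset.sum_congr rfl fun l' _ => ?_
    rw [fermionEmbed_add, fermionEmbed_smul, fermionEmbed_smul, fermionEmbed_mul, fermionEmbed_mul,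
      fermionEmbed_conjTranspose,
      ← iterate_hubbardTorusTT'_commutator_fermionEmbed L t t' U (i k) hΛ (hKi k) hInj (a l),
      ← iterate_hubbardTorusTT'_commutator_fermionEmbed L t t' U ((k : ℕ) - i k) hΛ (hKj k) hInj (a l'),
      hb, hb]
  -- in every translated Gibbs component the split cut has the expectation of the unbalanced cut
  have hsplit : ∀ (v : TorusSite 2 L) (c : Fin (sectorGibbsCount n L)),
      expect (∑ k : Fin (K + 1), ∑ l, ∑ l',
        ((((β ^ (k : ℕ) : ℝ) : ℂ) * P k l l') •
            (((fun X => hubbardTorusTT' L t t' U * X - X * hubbardTorusTT' L t t' U)^[i k] (b l))ᴴ *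
              (fun X => hubbardTorusTT' L t t' U * X - X * hubbardTorusTT' L t t' U)^[(k : ℕ) - i k] (b l')) +
          (((β ^ (k : ℕ) : ℝ) : ℂ) * Q k l l') •
            ((fun X => hubbardTorusTT' L t t' U * X - X * hubbardTorusTT' L t t' U)^[(k : ℕ) - i k] (b l') *
              ((fun X => hubbardTorusTT' L t t' U * X - X * hubbardTorusTT' L t t' U)^[i k] (b l))ᴴ)))
        ((fockTranslate v).val *ᵥ sectorGibbsVectorTT' t t' U n L c) =
      expect (∑ k : Fin (K + 1), ∑ l, ∑ l',
        ((((β ^ (k : ℕ) : ℝ) : ℂ) * P k l l') • ((b l)ᴴ *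
            (fun X => hubbardTorusTT' L t t' U * X - X * hubbardTorusTT' L t t' U)^[(k : ℕ)] (b l')) +
          (((β ^ (k : ℕ) : ℝ) : ℂ) * Q k l l') •
            ((fun X => hubbardTorusTT' L t t' U * X - X * hubbardTorusTT' L t t' U)^[(k : ℕ)] (b l') * (b l)ᴴ)))
        ((fockTranslate v).val *ᵥ sectorGibbsVectorTT' t t' U n L c) := fun v c =>
    star_dotProduct_momentCutSplit_mulVec_eq (hubbardTorusTT'_isHermitian L t t' U)
      (star_fockTranslate_mulVec_dotProduct_commutator_mulVec_eq_zero L t t' U n v c) b β P Q i hi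
  -- each translate is nonnegative
  have hv : ∀ v : TorusSite 2 L, 0 ≤ ∑ c, sectorGibbsWeightTT' β t t' U n L c *
      (expect (∑ k : Fin (K + 1), ∑ l, ∑ l',
        ((((β ^ (k : ℕ) : ℝ) : ℂ) * P k l l') • ((b l)ᴴ *
            (fun X => hubbardTorusTT' L t t' U * X - X * hubbardTorusTT' L t t' U)^[(k : ℕ)] (b l')) +
          (((β ^ (k : ℕ) : ℝ) : ℂ) * Q k l l') •
            ((fun X => hubbardTorusTT' L t t' U * X - X * hubbardTorusTT' L t t' U)^[(k : ℕ)] (b l') * (b l)ᴴ)))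
        ((fockTranslate v).val *ᵥ sectorGibbsVectorTT' t t' U n L c)).re := fun v =>
    sum_sectorGibbsWeightTT'_mul_re_expect_momentCut_fockTranslate_nonneg L t t' U n β v hbN hbS hPi
  have hcast : ((Fintype.card (TorusSite 2 L) : ℂ))⁻¹ = (((Fintype.card (TorusSite 2 L) : ℝ)⁻¹ : ℝ) : ℂ) := by
    push_cast; rfl
  simp_rw [torusAvgExpectAt_of_injOn L h₁, hΓ, hsplit]
  rw [Complex.re_sum]
  simp_rw [hcast, ← mul_assoc, ← Complex.ofReal_mul, Complex.re_ofReal_mul, Complex.re_sum, Finset.mul_sum]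
  rw [Finset.sum_comm]
  refine Finset.sum_nonneg fun v _ => ?_
  have hfac : ∀ (g : Fin (sectorGibbsCount n L) → ℝ),
      ∑ c, sectorGibbsWeightTT' β t t' U n L c * (Fintype.card (TorusSite 2 L) : ℝ)⁻¹ * g c =
        (Fintype.card (TorusSite 2 L) : ℝ)⁻¹ * ∑ c, sectorGibbsWeightTT' β t t' U n L c * g c := by
    intro g
    rw [Finset.mul_sum]
    exact Finset.sum_congr rfl fun c _ => by ring
  rw [hfac]
  exact mul_nonneg (inv_nonneg.2 (Nat.cast_nonneg _)) (hv v)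

end TorusAverage

/-! ### §3 KMS moment rows of thermal torus-limit states on split words -/

namespace InfVolFermionState

variable {m : Type*} [Fintype m]

/-- **KMS moment cuts of thermal torus limits on split (Krylov) words.** Let `ω` be a torus limit of the
canonical Gibbs states of `hubbardTorusTT' (Ls j) t t' U` at inverse temperature `β` on the sectors
`(rectN n (Ls j), S^z = 0)` along `Ls → ∞`. Then for every region `Λ`, every split `i_k ≤ k` (`k ≤ K`), every
window `Λ' ⊇ Λ` containing the shells `(thicken · 1)^[i_k] Λ` and `(thicken · 1)^[k − i_k] Λ` for all `k ≤ K`,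
every finite family of local generators `a_l ∈ 𝔄_Λ` conserving the local particle number and `S^z`, and all
coefficient matrices `P, Q : Fin (K+1) → Matrix m m ℂ` with `Σ_k u^k P_k + e^{−u} Σ_k u^k Q_k ⪰ 0` for all real `u`:
`0 ≤ Re ω_{Λ'}(Σ_k Σ_{l l'} β^k [(P_k)_{l l'} · (ad^{i_k} Γa_l)ᴴ ad^{k−i_k}(Γa_{l'}) + (Q_k)_{l l'} · ad^{k−i_k}(Γa_{l'}) (ad^{i_k} Γa_l)ᴴ])`,
`ad = ad_{H^{tt'}_{Λ'}}`, `Γ = Γ_{Λ⊆Λ'}` — the cut of `re_expect_momentCut_nonneg_of_sectorGibbs` with the `k`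
commutators distributed over the two factors; the balanced split needs only the window of radius `⌈K/2⌉`.
[cite: FawziFawziScalet2024, Thm. 3.1] [cite: ItoiEtAl2023, Lemma 5] -/
theorem IsTorusLimitOfMixture.re_expect_momentCutSplit_nonneg_of_sectorGibbs
    (t t' U : ℝ) {n : ℝ} (β : ℝ) {ω : InfVolFermionState 2} {Ls : ℕ → ℕ}
    (h : ω.IsTorusLimitOfMixture (sectorGibbsCount n) (fun L => sectorGibbsWeightTT' β t t' U n L)
      (fun L => sectorGibbsVectorTT' t t' U n L) Ls)
    (hLs : Tendsto Ls atTop atTop) {Λ Λ' : Finset (Site 2)} (hΛ : Λ ⊆ Λ') {K : ℕ}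
    (i : Fin (K + 1) → ℕ) (hi : ∀ k, i k ≤ (k : ℕ))
    (hKi : ∀ k : Fin (K + 1), (fun S : Finset (Site 2) => thicken S 1)^[i k] Λ ⊆ Λ')
    (hKj : ∀ k : Fin (K + 1), (fun S : Finset (Site 2) => thicken S 1)^[(k : ℕ) - i k] Λ ⊆ Λ')
    {a : m → FermionOp Λ} (haN : ∀ l, Commute (a l) totalNumber) (haS : ∀ l, Commute (a l) HubbardWave0.spinZ)
    {P Q : Fin (K + 1) → Matrix m m ℂ}
    (hPi : ∀ u : ℝ, (∑ k : Fin (K + 1), ((u ^ (k : ℕ) : ℝ) : ℂ) • P k +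
        ((Real.exp (-u) : ℝ) : ℂ) • ∑ k : Fin (K + 1), ((u ^ (k : ℕ) : ℝ) : ℂ) • Q k).PosSemidef) :
    0 ≤ (ω.expect Λ'
      (∑ k : Fin (K + 1), ∑ l, ∑ l',
        ((((β ^ (k : ℕ) : ℝ) : ℂ) * P k l l') •
            (((fun Y : FermionOp Λ' => (hubbardTTPrimeFermionInteraction t t' U).localHamiltonian Λ' * Y -
                Y * (hubbardTTPrimeFermionInteraction t t' U).localHamiltonian Λ')^[i k]
              (fermionEmbed (PolySite.incl hΛ) (a l)))ᴴ *
            (fun Y : FermionOp Λ' => (hubbardTTPrimeFermionInteraction t t' U).localHamiltonian Λ' * Y -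
                Y * (hubbardTTPrimeFermionInteraction t t' U).localHamiltonian Λ')^[(k : ℕ) - i k]
              (fermionEmbed (PolySite.incl hΛ) (a l'))) +
          (((β ^ (k : ℕ) : ℝ) : ℂ) * Q k l l') •
            ((fun Y : FermionOp Λ' => (hubbardTTPrimeFermionInteraction t t' U).localHamiltonian Λ' * Y -
                Y * (hubbardTTPrimeFermionInteraction t t' U).localHamiltonian Λ')^[(k : ℕ) - i k]
              (fermionEmbed (PolySite.incl hΛ) (a l')) *
            ((fun Y : FermionOp Λ' => (hubbardTTPrimeFermionInteraction t t' U).localHamiltonian Λ' * Y -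
                Y * (hubbardTTPrimeFermionInteraction t t' U).localHamiltonian Λ')^[i k]
              (fermionEmbed (PolySite.incl hΛ) (a l)))ᴴ)))).re := by
  refine ge_of_tendsto ((Complex.continuous_re.tendsto _).comp (h Λ' _)) ?_
  filter_upwards [eventually_injOn_proj_of_tendsto (thicken Λ' 1) hLs, hLs.eventually_ge_atTop 1]
    with j hInj hj
  haveI : NeZero (Ls j) := ⟨by omega⟩
  rw [Function.comp_apply]
  simp_rw [torusAvgExpect_eq]
  exact re_sum_sectorGibbsWeightTT'_mul_torusAvgExpectAt_momentCutSplit_nonneg (Ls j) t t' U n β hΛ i hi hKi hKj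
    hInj haN haS hPi

/-- **Scalar KMS moment rows of thermal torus limits on split (Krylov) words.** Same torus-limit object; for
a single local generator `a ∈ 𝔄_Λ` conserving the local `N` and `S^z`, a split `i_k ≤ k`, a window `Λ' ⊇ Λ`
containing `(thicken · 1)^[i_k] Λ` and `(thicken · 1)^[k − i_k] Λ` for all `k ≤ K`, and real coefficients
`p_k, q_k` with `0 ≤ Σ_k p_k u^k + e^{−u} Σ_k q_k u^k` for every real `u`:
`0 ≤ Re ω_{Λ'}(Σ_k β^k [p_k · (ad^{i_k} Γa)ᴴ ad^{k−i_k}(Γa) + q_k · ad^{k−i_k}(Γa) (ad^{i_k} Γa)ᴴ])` — the rows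
`Σ_k β^k p_k ω((C_a^{i_k})† C_a^{k−i_k}) + Σ_k β^k q_k ω(C_a^{k−i_k} (C_a^{i_k})†) ≥ 0`, `C_a^i = [H,[H,…[H,a]…]]`,
equal row by row to `re_expect_momentRow_nonneg_of_sectorGibbs` but readable on the Gram data of
`{a, ad a, …, ad^{⌈K/2⌉} a}`. [cite: ItoiEtAl2023, Theorem 3] [cite: FawziFawziScalet2024, Thm. 3.1] -/
theorem IsTorusLimitOfMixture.re_expect_momentRowSplit_nonneg_of_sectorGibbs
    (t t' U : ℝ) {n : ℝ} (β : ℝ) {ω : InfVolFermionState 2} {Ls : ℕ → ℕ}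
    (h : ω.IsTorusLimitOfMixture (sectorGibbsCount n) (fun L => sectorGibbsWeightTT' β t t' U n L)
      (fun L => sectorGibbsVectorTT' t t' U n L) Ls)
    (hLs : Tendsto Ls atTop atTop) {Λ Λ' : Finset (Site 2)} (hΛ : Λ ⊆ Λ') {K : ℕ}
    (i : Fin (K + 1) → ℕ) (hi : ∀ k, i k ≤ (k : ℕ))
    (hKi : ∀ k : Fin (K + 1), (fun S : Finset (Site 2) => thicken S 1)^[i k] Λ ⊆ Λ')
    (hKj : ∀ k : Fin (K + 1), (fun S : Finset (Site 2) => thicken S 1)^[(k : ℕ) - i k] Λ ⊆ Λ')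
    {a : FermionOp Λ} (haN : Commute a totalNumber) (haS : Commute a HubbardWave0.spinZ)
    {p q : Fin (K + 1) → ℝ}
    (hpq : ∀ u : ℝ, 0 ≤ ∑ k, p k * u ^ (k : ℕ) + Real.exp (-u) * ∑ k, q k * u ^ (k : ℕ)) :
    0 ≤ (ω.expect Λ'
      (∑ k : Fin (K + 1),
        ((((β ^ (k : ℕ) * p k : ℝ) : ℂ)) •
            (((fun Y : FermionOp Λ' => (hubbardTTPrimeFermionInteraction t t' U).localHamiltonian Λ' * Y -
                Y * (hubbardTTPrimeFermionInteraction t t' U).localHamiltonian Λ')^[i k]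
              (fermionEmbed (PolySite.incl hΛ) a))ᴴ *
            (fun Y : FermionOp Λ' => (hubbardTTPrimeFermionInteraction t t' U).localHamiltonian Λ' * Y -
                Y * (hubbardTTPrimeFermionInteraction t t' U).localHamiltonian Λ')^[(k : ℕ) - i k]
              (fermionEmbed (PolySite.incl hΛ) a)) +
          (((β ^ (k : ℕ) * q k : ℝ) : ℂ)) •
            ((fun Y : FermionOp Λ' => (hubbardTTPrimeFermionInteraction t t' U).localHamiltonian Λ' * Y -
                Y * (hubbardTTPrimeFermionInteraction t t' U).localHamiltonian Λ')^[(k : ℕ) - i k]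
              (fermionEmbed (PolySite.incl hΛ) a) *
            ((fun Y : FermionOp Λ' => (hubbardTTPrimeFermionInteraction t t' U).localHamiltonian Λ' * Y -
                Y * (hubbardTTPrimeFermionInteraction t t' U).localHamiltonian Λ')^[i k]
              (fermionEmbed (PolySite.incl hΛ) a))ᴴ)))).re := by
  have h' := h.re_expect_momentCutSplit_nonneg_of_sectorGibbs t t' U β hLs hΛ i hi hKi hKj (a := fun _ : Unit => a)
    (fun _ => haN) (fun _ => haS)
    (P := fun k => ((p k : ℝ) : ℂ) • (1 : Matrix Unit Unit ℂ))
    (Q := fun k => ((q k : ℝ) : ℂ) • (1 : Matrix Unit Unit ℂ)) fun u => posSemidef_momentCut_unit_of_nonneg (hpq u)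
  rwa [momentCut_unit_eq_of_words] at h'

/-- **Scalar KMS moment row on split words from a line certificate** (the reader's entry point, list format of
`ExpPolynomialLineNonneg.lean`): rational lists `lp, lq` of length `≤ K + 1` with
`0 ≤ lp(u) + e^{−u} lq(u)` on the whole line give, for every split `i_k ≤ k` whose shells fit into the window,
`0 ≤ Re ω_{Λ'}(Σ_k β^k [lp[k] · (ad^{i_k} Γa)ᴴ ad^{k−i_k}(Γa) + lq[k] · ad^{k−i_k}(Γa) (ad^{i_k} Γa)ᴴ])` — the split
twin of `re_expect_momentRow_nonneg_of_sectorGibbs_of_lineCert` (same sidecar: word, `K`, split, window,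
`lp`, `lq`, tails-and-leaves certificate). [cite: ItoiEtAl2023, Theorem 3] [cite: FawziFawziScalet2024, Thm. 3.1] -/
theorem IsTorusLimitOfMixture.re_expect_momentRowSplit_nonneg_of_sectorGibbs_of_lineCert
    (t t' U : ℝ) {n : ℝ} (β : ℝ) {ω : InfVolFermionState 2} {Ls : ℕ → ℕ}
    (h : ω.IsTorusLimitOfMixture (sectorGibbsCount n) (fun L => sectorGibbsWeightTT' β t t' U n L)
      (fun L => sectorGibbsVectorTT' t t' U n L) Ls)
    (hLs : Tendsto Ls atTop atTop) {Λ Λ' : Finset (Site 2)} (hΛ : Λ ⊆ Λ') {K : ℕ}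
    (i : Fin (K + 1) → ℕ) (hi : ∀ k, i k ≤ (k : ℕ))
    (hKi : ∀ k : Fin (K + 1), (fun S : Finset (Site 2) => thicken S 1)^[i k] Λ ⊆ Λ')
    (hKj : ∀ k : Fin (K + 1), (fun S : Finset (Site 2) => thicken S 1)^[(k : ℕ) - i k] Λ ⊆ Λ')
    {a : FermionOp Λ} (haN : Commute a totalNumber) (haS : Commute a HubbardWave0.spinZ)
    {lp lq : Poly} (hp : lp.length ≤ K + 1) (hq : lq.length ≤ K + 1)
    (hline : ∀ u : ℝ, 0 ≤ Poly.eval lp u + Real.exp (-u) * Poly.eval lq u) :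
    0 ≤ (ω.expect Λ'
      (∑ k : Fin (K + 1),
        ((((β ^ (k : ℕ) * ((lp.getD (k : ℕ) 0 : ℚ) : ℝ) : ℝ) : ℂ)) •
            (((fun Y : FermionOp Λ' => (hubbardTTPrimeFermionInteraction t t' U).localHamiltonian Λ' * Y -
                Y * (hubbardTTPrimeFermionInteraction t t' U).localHamiltonian Λ')^[i k]
              (fermionEmbed (PolySite.incl hΛ) a))ᴴ *
            (fun Y : FermionOp Λ' => (hubbardTTPrimeFermionInteraction t t' U).localHamiltonian Λ' * Y -
                Y * (hubbardTTPrimeFermionInteraction t t' U).localHamiltonian Λ')^[(k : ℕ) - i k]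
              (fermionEmbed (PolySite.incl hΛ) a)) +
          (((β ^ (k : ℕ) * ((lq.getD (k : ℕ) 0 : ℚ) : ℝ) : ℝ) : ℂ)) •
            ((fun Y : FermionOp Λ' => (hubbardTTPrimeFermionInteraction t t' U).localHamiltonian Λ' * Y -
                Y * (hubbardTTPrimeFermionInteraction t t' U).localHamiltonian Λ')^[(k : ℕ) - i k]
              (fermionEmbed (PolySite.incl hΛ) a) *
            ((fun Y : FermionOp Λ' => (hubbardTTPrimeFermionInteraction t t' U).localHamiltonian Λ' * Y -
                Y * (hubbardTTPrimeFermionInteraction t t' U).localHamiltonian Λ')^[i k]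
              (fermionEmbed (PolySite.incl hΛ) a))ᴴ)))).re :=
  h.re_expect_momentRowSplit_nonneg_of_sectorGibbs t t' U β hLs hΛ i hi hKi hKj haN haS
    (p := fun k => ((lp.getD (k : ℕ) 0 : ℚ) : ℝ)) (q := fun k => ((lq.getD (k : ℕ) 0 : ℚ) : ℝ))
    (momentRow_hyp_of_expPolyLine_nonneg hp hq hline)

/-- The BALANCED split `i_k = ⌊k/2⌋` fits into every window containing the `⌈K/2⌉ = (K+1)/2`-th shell.
[cite: BratteliRobinsonII1997, Thm. 6.2.4] -/
theorem iterate_thicken_one_half_subset {Λ Λ' : Finset (Site 2)} {K : ℕ}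
    (hK : (fun S : Finset (Site 2) => thicken S 1)^[(K + 1) / 2] Λ ⊆ Λ') (k : Fin (K + 1)) :
    (fun S : Finset (Site 2) => thicken S 1)^[(k : ℕ) / 2] Λ ⊆ Λ' ∧
      (fun S : Finset (Site 2) => thicken S 1)^[(k : ℕ) - (k : ℕ) / 2] Λ ⊆ Λ' := by
  have hk : (k : ℕ) ≤ K := Nat.lt_succ_iff.mp k.2
  exact ⟨(iterate_thicken_one_subset_of_le (by omega) Λ).trans hK,
    (iterate_thicken_one_subset_of_le (by omega) Λ).trans hK⟩

/-- **Balanced scalar KMS moment row from a line certificate**: with the split `i_k = ⌊k/2⌋` the order-`K`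
row `0 ≤ Re ω_{Λ'}(Σ_k β^k [lp[k] · (ad^{⌊k/2⌋} Γa)ᴴ ad^{⌈k/2⌉}(Γa) + lq[k] · ad^{⌈k/2⌉}(Γa) (ad^{⌊k/2⌋} Γa)ᴴ])` holds
in every window `Λ' ⊇ (thicken · 1)^[(K+1)/2] Λ` — HALF the radius of the unbalanced row (orders `K = 3, 4`
need only the second shell, `K = 5, 6` the third). [cite: ItoiEtAl2023, Lemma 5] [cite: FawziFawziScalet2024, Thm. 3.1] -/
theorem IsTorusLimitOfMixture.re_expect_momentRowBalanced_nonneg_of_sectorGibbs_of_lineCert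
    (t t' U : ℝ) {n : ℝ} (β : ℝ) {ω : InfVolFermionState 2} {Ls : ℕ → ℕ}
    (h : ω.IsTorusLimitOfMixture (sectorGibbsCount n) (fun L => sectorGibbsWeightTT' β t t' U n L)
      (fun L => sectorGibbsVectorTT' t t' U n L) Ls)
    (hLs : Tendsto Ls atTop atTop) {Λ Λ' : Finset (Site 2)} (hΛ : Λ ⊆ Λ') {K : ℕ}
    (hK : (fun S : Finset (Site 2) => thicken S 1)^[(K + 1) / 2] Λ ⊆ Λ')
    {a : FermionOp Λ} (haN : Commute a totalNumber) (haS : Commute a HubbardWave0.spinZ)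
    {lp lq : Poly} (hp : lp.length ≤ K + 1) (hq : lq.length ≤ K + 1)
    (hline : ∀ u : ℝ, 0 ≤ Poly.eval lp u + Real.exp (-u) * Poly.eval lq u) :
    0 ≤ (ω.expect Λ'
      (∑ k : Fin (K + 1),
        ((((β ^ (k : ℕ) * ((lp.getD (k : ℕ) 0 : ℚ) : ℝ) : ℝ) : ℂ)) •
            (((fun Y : FermionOp Λ' => (hubbardTTPrimeFermionInteraction t t' U).localHamiltonian Λ' * Y -
                Y * (hubbardTTPrimeFermionInteraction t t' U).localHamiltonian Λ')^[(k : ℕ) / 2]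
              (fermionEmbed (PolySite.incl hΛ) a))ᴴ *
            (fun Y : FermionOp Λ' => (hubbardTTPrimeFermionInteraction t t' U).localHamiltonian Λ' * Y -
                Y * (hubbardTTPrimeFermionInteraction t t' U).localHamiltonian Λ')^[(k : ℕ) - (k : ℕ) / 2]
              (fermionEmbed (PolySite.incl hΛ) a)) +
          (((β ^ (k : ℕ) * ((lq.getD (k : ℕ) 0 : ℚ) : ℝ) : ℝ) : ℂ)) •
            ((fun Y : FermionOp Λ' => (hubbardTTPrimeFermionInteraction t t' U).localHamiltonian Λ' * Y -
                Y * (hubbardTTPrimeFermionInteraction t t' U).localHamiltonian Λ')^[(k : ℕ) - (k : ℕ) / 2]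
              (fermionEmbed (PolySite.incl hΛ) a) *
            ((fun Y : FermionOp Λ' => (hubbardTTPrimeFermionInteraction t t' U).localHamiltonian Λ' * Y -
                Y * (hubbardTTPrimeFermionInteraction t t' U).localHamiltonian Λ')^[(k : ℕ) / 2]
              (fermionEmbed (PolySite.incl hΛ) a))ᴴ)))).re :=
  h.re_expect_momentRowSplit_nonneg_of_sectorGibbs_of_lineCert t t' U β hLs hΛ (fun k => (k : ℕ) / 2)
    (fun _ => Nat.div_le_self _ _) (fun k => (iterate_thicken_one_half_subset hK k).1)
    (fun k => (iterate_thicken_one_half_subset hK k).2) haN haS hp hq hline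

end InfVolFermionState

/-! ### §4 Finite clusters: the split cut in a canonical sector Gibbs eigen-mixture (unit tests of producers) -/

section Cluster

variable {ι : Type*} [Fintype ι] [DecidableEq ι] (p : ι → Prop) [DecidablePred p]
variable {m : Type*} [Fintype m]

/-- **KMS moment cut on split (Krylov) words for a canonical SECTOR Gibbs eigen-mixture of a finite cluster**:
under the hypotheses of `sum_canonicalWeight_mul_re_expect_momentCut_nonneg` (`A` Hermitian and block diagonal
for the sector `p`; generators `a_l`, `a_lᴴ` sector preserving; `Σ_k u^k P_k + e^{−u} Σ_k u^k Q_k ⪰ 0` on `ℝ`) and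
for every split `i_k ≤ k`:
`0 ≤ Σ_c w_c Re⟨ψ_c, Σ_k Σ_{l l'} β^k [(P_k)_{l l'} (ad^{i_k} a_l)ᴴ ad^{k−i_k}(a_{l'}) + (Q_k)_{l l'} ad^{k−i_k}(a_{l'}) (ad^{i_k} a_l)ᴴ] ψ_c⟩`
— each sector eigenvector is stationary (`mulVec_sectorEigenvector`), so the split cut has the value of the
unbalanced one component by component. (On a cluster every word is available; this form is for unit tests of
split-word producers against exact Gibbs data.) [cite: ItoiEtAl2023, Lemma 5] [cite: FawziFawziScalet2024, Thm. 3.4] -/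
theorem sum_canonicalWeight_mul_re_expect_momentCutSplit_nonneg {A : Matrix ι ι ℂ} (hA : A.IsHermitian)
    (hinv : ∀ i j, ¬ p i → p j → A i j = 0) {a : m → Matrix ι ι ℂ}
    (ha : ∀ l i j, ¬ p i → p j → a l i j = 0) (ha' : ∀ l i j, ¬ p i → p j → (a l)ᴴ i j = 0)
    (β : ℝ) {K : ℕ} (i : Fin (K + 1) → ℕ) (hi : ∀ k, i k ≤ (k : ℕ)) {P Q : Fin (K + 1) → Matrix m m ℂ}
    (hPi : ∀ u : ℝ, (∑ k : Fin (K + 1), ((u ^ (k : ℕ) : ℝ) : ℂ) • P k +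
        ((Real.exp (-u) : ℝ) : ℂ) • ∑ k : Fin (K + 1), ((u ^ (k : ℕ) : ℝ) : ℂ) • Q k).PosSemidef) :
    0 ≤ ∑ c, canonicalWeight β (sectorEigenvalue p A hA) c *
      (star (sectorEigenvector p A hA c) ⬝ᵥ
        ((∑ k : Fin (K + 1), ∑ l, ∑ l',
            ((((β ^ (k : ℕ) : ℝ) : ℂ) * P k l l') •
                (((fun Y : Matrix ι ι ℂ => A * Y - Y * A)^[i k] (a l))ᴴ *
                  (fun Y : Matrix ι ι ℂ => A * Y - Y * A)^[(k : ℕ) - i k] (a l')) +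
              (((β ^ (k : ℕ) : ℝ) : ℂ) * Q k l l') •
                ((fun Y : Matrix ι ι ℂ => A * Y - Y * A)^[(k : ℕ) - i k] (a l') *
                  ((fun Y : Matrix ι ι ℂ => A * Y - Y * A)^[i k] (a l))ᴴ))) *ᵥ
          sectorEigenvector p A hA c)).re := by
  refine (sum_canonicalWeight_mul_re_expect_momentCut_nonneg p hA hinv ha ha' β hPi).trans_eq
    (Finset.sum_congr rfl fun c _ => ?_)
  rw [star_dotProduct_momentCutSplit_mulVec_eq hA
    (fun Y => star_dotProduct_commutator_mulVec_eq_zero_of_eigenvector hA (mulVec_sectorEigenvector p hA hinv c) Y)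
    a β P Q i hi]

/-- **Scalar KMS moment row on split words for a canonical sector Gibbs eigen-mixture of a finite cluster**
(`m = 1`; hypothesis `0 ≤ Σ_k p_k u^k + e^{−u} Σ_k q_k u^k` on `ℝ`). [cite: ItoiEtAl2023, Theorem 3] -/
theorem sum_canonicalWeight_mul_re_expect_momentRowSplit_nonneg {A : Matrix ι ι ℂ} (hA : A.IsHermitian)
    (hinv : ∀ i j, ¬ p i → p j → A i j = 0) {a : Matrix ι ι ℂ}
    (ha : ∀ i j, ¬ p i → p j → a i j = 0) (ha' : ∀ i j, ¬ p i → p j → aᴴ i j = 0)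
    (β : ℝ) {K : ℕ} (i : Fin (K + 1) → ℕ) (hi : ∀ k, i k ≤ (k : ℕ)) {p' q' : Fin (K + 1) → ℝ}
    (hpq : ∀ u : ℝ, 0 ≤ ∑ k, p' k * u ^ (k : ℕ) + Real.exp (-u) * ∑ k, q' k * u ^ (k : ℕ)) :
    0 ≤ ∑ c, canonicalWeight β (sectorEigenvalue p A hA) c *
      (star (sectorEigenvector p A hA c) ⬝ᵥ
        ((∑ k : Fin (K + 1),
            ((((β ^ (k : ℕ) * p' k : ℝ) : ℂ)) •
                (((fun Y : Matrix ι ι ℂ => A * Y - Y * A)^[i k] a)ᴴ *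
                  (fun Y : Matrix ι ι ℂ => A * Y - Y * A)^[(k : ℕ) - i k] a) +
              (((β ^ (k : ℕ) * q' k : ℝ) : ℂ)) •
                ((fun Y : Matrix ι ι ℂ => A * Y - Y * A)^[(k : ℕ) - i k] a *
                  ((fun Y : Matrix ι ι ℂ => A * Y - Y * A)^[i k] a)ᴴ))) *ᵥ
          sectorEigenvector p A hA c)).re := by
  have h := sum_canonicalWeight_mul_re_expect_momentCutSplit_nonneg p hA hinv (a := fun _ : Unit => a)
    (fun _ => ha) (fun _ => ha') β i hi
    (P := fun k => ((p' k : ℝ) : ℂ) • (1 : Matrix Unit Unit ℂ))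
    (Q := fun k => ((q' k : ℝ) : ℂ) • (1 : Matrix Unit Unit ℂ)) fun u => posSemidef_momentCut_unit_of_nonneg (hpq u)
  rwa [momentCut_unit_eq_of_words] at h

/-- **Scalar KMS moment row on split words for a finite cluster, from a line certificate** (lists `lp, lq` as in
`ExpPolynomialLineNonneg.lean`; the cluster twin of
`IsTorusLimitOfMixture.re_expect_momentRowSplit_nonneg_of_sectorGibbs_of_lineCert`). [cite: ItoiEtAl2023, Theorem 3] -/
theorem sum_canonicalWeight_mul_re_expect_momentRowSplit_nonneg_of_lineCert {A : Matrix ι ι ℂ} (hA : A.IsHermitian)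
    (hinv : ∀ i j, ¬ p i → p j → A i j = 0) {a : Matrix ι ι ℂ}
    (ha : ∀ i j, ¬ p i → p j → a i j = 0) (ha' : ∀ i j, ¬ p i → p j → aᴴ i j = 0)
    (β : ℝ) {K : ℕ} (i : Fin (K + 1) → ℕ) (hi : ∀ k, i k ≤ (k : ℕ))
    {lp lq : Poly} (hp : lp.length ≤ K + 1) (hq : lq.length ≤ K + 1)
    (hline : ∀ u : ℝ, 0 ≤ Poly.eval lp u + Real.exp (-u) * Poly.eval lq u) :
    0 ≤ ∑ c, canonicalWeight β (sectorEigenvalue p A hA) c *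
      (star (sectorEigenvector p A hA c) ⬝ᵥ
        ((∑ k : Fin (K + 1),
            ((((β ^ (k : ℕ) * ((lp.getD (k : ℕ) 0 : ℚ) : ℝ) : ℝ) : ℂ)) •
                (((fun Y : Matrix ι ι ℂ => A * Y - Y * A)^[i k] a)ᴴ *
                  (fun Y : Matrix ι ι ℂ => A * Y - Y * A)^[(k : ℕ) - i k] a) +
              (((β ^ (k : ℕ) * ((lq.getD (k : ℕ) 0 : ℚ) : ℝ) : ℝ) : ℂ)) •
                ((fun Y : Matrix ι ι ℂ => A * Y - Y * A)^[(k : ℕ) - i k] a *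
                  ((fun Y : Matrix ι ι ℂ => A * Y - Y * A)^[i k] a)ᴴ))) *ᵥ
          sectorEigenvector p A hA c)).re :=
  sum_canonicalWeight_mul_re_expect_momentRowSplit_nonneg p hA hinv ha ha' β i hi
    (p' := fun k => ((lp.getD (k : ℕ) 0 : ℚ) : ℝ)) (q' := fun k => ((lq.getD (k : ℕ) 0 : ℚ) : ℝ))
    (momentRow_hyp_of_expPolyLine_nonneg hp hq hline)

end Cluster

end Literature.MathematicalPhysics.QuantumLattice

end
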